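import Literature.AlgebraicGeometry.Resolution.CentreBlowupAdaptedOrder
import Mathlib.Algebra.MvPolynomial.PDeriv
import HarnessLib

/-!
# [CP19] Theorem 3.6 at centres of the SECOND kind: neither `ε` nor `ω` increases over `x`,
# proved in the coordinate model

Topic: `Literature/AlgebraicGeometry/Resolution`.  Cell `pub-rosobs` (resolution observatory).  This is
the model theorem of unit `pub-rosobs-carver-g24` (staged 2026-08-20 as
`Summits/ResolutionOfSingularities/KangarooAtlas/SecondKindOmega.lean`, STAFFING item 8 of the cell;
proofs unchanged, helper lemmas made private, namespace `CentreBlowup.SecondKind`), placed here by unit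
`pub-rosobs-carver-g25` next to its first-kind companion `CentreBlowupThm36FirstKind.lean`; the two
halves are combined in `CentreBlowupThm36Permissible.lean`.

* V. Cossart, O. Piltant, *Resolution of singularities of arithmetical threefolds*, J. Algebra **529**
  (2019) 268–535 = arXiv:1412.0868 [CossartPiltant2019], Theorem 3.6 (p. 35): "Let `π : 𝒳' → 𝒳` be
  the blowing up along a permissible center `𝒴` (of the first kind or second kind) at `x`,
  `x' ∈ π⁻¹(x)` … Then `(m(x'), ω(x'), κ(x')) ≤ (m(x), ω(x), κ(x))`. … If `ε(x') > ε(x)`, the following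
  holds: (1) we have `i₀(m_S) = p`, `ε(y) = ε(x) = ω(x)`, …"; Definition 3.2 (p. 32: second kind =
  Hironaka-permissible, `ε(y) = ε(x) − 1`, (iii) `J̄(F_{p,Z,W},E,W) ≠ 0`) with Proposition 3.3 (p. 32:
  at a second-kind centre `H⁻¹F_{p,Z} = <Σ_{j'∈J'} U_{j'}Φ_{j'} + Ψ>`, `Φ_{j'} ≠ 0` for some
  `j' ∈ J' ∖ (J')_E`, and `ε(y) = ω(x)`); Remark 3.2 (p. 41: without (iii), `ω` does increase).

## Setting

The model of `PointBlowupShadeCentres` / `CentreBlowupAdaptedOrder`: `h = Z^q + F(u)`, `G = 0`, a state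
`s = (F, r, exc)`, one `step q S j b s` = blow-up of the coordinate centre `C_S = V(Z, {u_i}_{i∈S})`,
chart `u_j` (`j ∈ S`), translation to the point `b` of the chart (`b_j = 0`, `b = 0` off `S`: the fibre
over `x`), cleaning.  `ε(x) = s.epsilon`, `ω(x) = s.omega`, `ε(y) = epsilonAlong S s`;
`IsSecondKind q S s` is Def. 3.2 with (iii) in the Prop. 3.3 form (a transverse-linear monomial
`u_t·u^m` of least `S`-degree, `t ∉ S ∪ exc`).

## What is proved (every field `K`, every finite index type `σ`; `q ≠ 1`)

* `epsilon_step_le` — **`ε(x') ≤ ε(x)`** from the numerical data of a second-kind centre (least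
  `S`-degree `k ≥ q`, a transverse-linear monomial of `S`-degree `k`, `ord₀ F = k + 1`), for ANY `exc`
  and any position of `t`: the transverse-linear SLICE of the `C_S`-step survives cleaning (`E_t = 1`,
  `q ≠ 1`) in the layer `u_j^{k−q}` with `|E| − Σ_{exc'} H_i(F') ≤ ε(x)` (layer lemma of
  `PointBlowupMohBound`; `H_j(F') ≥ k − q`, `H_i(F') ≥ H_i(F)` at untranslated old components);
* `omega_step_le` — **`ω(x') ≤ ω(x)`** if moreover `t ∉ exc` (Def. 3.2 (iii)): either
  `ord₀ F' < |E|` and `ε' ≤ ε − 1 ≤ ω`, or the slice lies in the new initial form and its `∂/∂u_t`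
  (`t ∉ exc'`) gives `V' ≠ 0`, `ω' = ε' − 1 ≤ ω`;
* `not_epsilonIncreases_of_isSecondKind`, `not_omegaIncreases_of_isSecondKind`,
  `noOmegaIncreaseAtCentre_of_isSecondKind` — at a centre of the second kind NEITHER `ε` NOR `ω`
  increases at any point over `x`: the second-kind halves of the atlas predicates
  `EpsilonIncreaseForcesFirstKindAt` / `NoOmegaIncreaseAtCentre` of `CentreBlowupAdaptedOrder.lean`
  (no use of `ω(x) > 0` or of the equimultiplicity of `x'`).

## Scope (what this is NOT)

Statements about the cell's combinatorial model only: fixed coordinates (no re-choice of well adapted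
coordinates after the step), `G = 0` (`i₀ = p`), a perfect-field reading of `V` and of the cleaning,
points `b` of the chart with `b = 0` off `S` (the fibre over the closed point `x`).  The citation tags
name the printed statements these model theorems read; they do not claim a formalisation of [CP19]'s
theorem for arithmetical threefolds.  The first-kind half of the `ω`-monotonicity is not treated.
-/

noncomputable section

open MvPolynomial Finset

open scoped BigOperators

namespace Literature.AlgebraicGeometry.Resolution.CentreBlowup.SecondKind

open Literature.AlgebraicGeometry.Resolution
open Literature.AlgebraicGeometry.Resolution.Hauser2010
open Literature.AlgebraicGeometry.Resolution.HauserPerlega2019 (initialForm)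
open Literature.Barriers.ResolutionOfSingularities
open Literature.AlgebraicGeometry.Resolution.CentreBlowup

/-! ## 1. Exponent bookkeeping -/

section Exponents

variable {σ : Type*} [DecidableEq σ]

omit [DecidableEq σ] in
/-- `|f.update j v| + f j = |f| + v`. [folklore] -/
private theorem degree_update_add (f : σ →₀ ℕ) (j : σ) (v : ℕ) : (f.update j v).degree + f j = f.degree + v := by
  rw [Finsupp.update_eq_erase_add_single, map_add, Finsupp.degree_single]
  conv_rhs => rw [← Finsupp.erase_add_single j f, map_add, Finsupp.degree_single]
  omega

/-- The chart exponent at the chart variable: `χ(d)_j = degIn S d − q`. [folklore] -/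
private theorem chartExponent_apply_self (q : ℕ) (S : Finset σ) (j : σ) (d : σ →₀ ℕ) :
    chartExponent q S j d j = degIn S d - q := by
  unfold chartExponent
  rw [Finsupp.update_apply, if_pos rfl]

/-- The chart exponent off the chart variable: `χ(d)_i = d_i`. [folklore] -/
private theorem chartExponent_apply_of_ne (q : ℕ) (S : Finset σ) {j i : σ} (h : i ≠ j) (d : σ →₀ ℕ) :
    chartExponent q S j d i = d i := by
  unfold chartExponent
  rw [Finsupp.update_apply, if_neg h]

/-- Degree of the chart exponent: `|χ(d)| + d_j = |d| + (degIn S d − q)`. [folklore] -/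
private theorem degree_chartExponent_add (q : ℕ) (S : Finset σ) (j : σ) (d : σ →₀ ℕ) :
    (chartExponent q S j d).degree + d j = d.degree + (degIn S d - q) :=
  degree_update_add d j _

/-- `χ` is injective on the monomials of a fixed `S`-degree (`j ∈ S`). [folklore] -/
private theorem eq_of_chartExponent_eq (q : ℕ) {S : Finset σ} {j : σ} (hj : j ∈ S) {k : ℕ} {d d' : σ →₀ ℕ}
    (hd : degIn S d = k) (hd' : degIn S d' = k) (h : chartExponent q S j d = chartExponent q S j d') :
    d = d' := by
  have hne : ∀ i, i ≠ j → d i = d' i := fun i hi => by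
    have h1 := congrArg (fun f => f i) h
    simp only [chartExponent_apply_of_ne q S hi] at h1
    exact h1
  ext i
  by_cases hi : i = j
  · subst hi
    have h1 := Finset.add_sum_erase S (fun x => d x) hj
    have h2 := Finset.add_sum_erase S (fun x => d' x) hj
    have h3 : ∑ x ∈ S.erase i, d x = ∑ x ∈ S.erase i, d' x :=
      Finset.sum_congr rfl fun x hx => hne x (Finset.ne_of_mem_erase hx)
    unfold degIn at hd hd'
    omega
  · exact hne i hi

end Exponents

/-! ## 2. The monomial `H(x)`: `bigH` bookkeeping -/

section BigH

variable {σ : Type*} {K : Type*} [CommRing K]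

/-- `H_i ≤ d_i` for every monomial `y^d` of `F`. [folklore] -/
private theorem bigH_le {F : MvPolynomial σ K} {d : σ →₀ ℕ} (hd : d ∈ F.support) (i : σ) :
    PointBlowup.bigH F i ≤ d i :=
  Finset.inf_le (f := fun d : σ →₀ ℕ => ((d i : ℕ) : ℕ∞)) hd

/-- `m ≤ H_i` when every monomial of `F` has `d_i ≥ m`. [folklore] -/
private theorem le_bigH_of_forall {F : MvPolynomial σ K} {i : σ} {m : ℕ} (h : ∀ d ∈ F.support, m ≤ d i) :
    (m : ℕ∞) ≤ PointBlowup.bigH F i :=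
  Finset.le_inf fun d hd => by exact_mod_cast h d hd

/-- For `F ≠ 0`, `H_i` is attained at some monomial (hence finite). [folklore] -/
private theorem exists_bigH_eq {F : MvPolynomial σ K} (hF : F ≠ 0) (i : σ) :
    ∃ d ∈ F.support, PointBlowup.bigH F i = d i := by
  obtain ⟨d, hd, h⟩ := Finset.exists_mem_eq_inf F.support (MvPolynomial.support_nonempty.mpr hF)
    (fun d : σ →₀ ℕ => ((d i : ℕ) : ℕ∞))
  exact ⟨d, hd, h⟩

/-- For `F ≠ 0`, `H_i = (H_i).toNat`. [folklore] -/
private theorem bigH_eq_toNat {F : MvPolynomial σ K} (hF : F ≠ 0) (i : σ) :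
    PointBlowup.bigH F i = ((PointBlowup.bigH F i).toNat : ℕ∞) := by
  obtain ⟨d, -, h⟩ := exists_bigH_eq hF i
  rw [h]
  rfl

end BigH

/-! ## 3. The transverse-linear slice of a `C_S`-step -/

section Slice

variable {σ : Type*} {K : Type*} [Field K] [Fintype σ] [DecidableEq σ] [DecidableEq K]

omit [Fintype σ] in
/-- The monomials of the new residual polynomial come from monomials of `F` through the chart law and the
translation. [folklore] -/
private theorem exists_of_mem_support_step (q : ℕ) (S : Finset σ) (j : σ) (b : σ → K) (s : CState σ K)
    {E : σ →₀ ℕ} (hE : E ∈ (step q S j b s).F.support) :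
    ∃ d ∈ s.F.support,
      coeff E (PointBlowup.translate b (monomial (chartExponent q S j d) (coeff d s.F))) ≠ 0 := by
  have h := MvPolynomial.mem_support_iff.mp hE
  change coeff E (deletePthPowers q (pointTransform q S j b s)) ≠ 0 at h
  rw [coeff_deletePthPowers] at h
  split_ifs at h with hP
  · exact (h rfl).elim
  · rw [pointTransform_eq_sum, coeff_sum] at h
    exact Finset.exists_ne_zero_of_sum_ne_zero h

/-- After a `C_S`-step at a point with `b_j = 0`, every monomial has `y_j`-exponent `≥ ord_{C_S} F − q`:
`H_j(F') ≥ k − q`. [folklore] -/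
private theorem le_bigH_step_self (q : ℕ) (S : Finset σ) (j : σ) (b : σ → K) (hbj : b j = 0) (s : CState σ K)
    {k : ℕ} (hmin : ∀ d ∈ s.F.support, k ≤ degIn S d) :
    ((k - q : ℕ) : ℕ∞) ≤ PointBlowup.bigH (step q S j b s).F j := by
  refine le_bigH_of_forall fun E hE => ?_
  obtain ⟨d, hd, hne⟩ := exists_of_mem_support_step q S j b s hE
  rw [PointBlowup.apply_eq_of_coeff_translate_monomial_ne_zero b hbj hne, chartExponent_apply_self]
  exact Nat.sub_le_sub_right (hmin d hd) q

/-- After a `C_S`-step, at an untranslated variable `i ≠ j` (`b_i = 0`) the minimal exponent does not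
decrease: `H_i(F') ≥ H_i(F)`. [folklore] -/
private theorem bigH_le_bigH_step (q : ℕ) (S : Finset σ) {j i : σ} (hij : i ≠ j) (b : σ → K) (hbi : b i = 0)
    (s : CState σ K) : PointBlowup.bigH s.F i ≤ PointBlowup.bigH (step q S j b s).F i := by
  refine Finset.le_inf fun E hE => ?_
  obtain ⟨d, hd, hne⟩ := exists_of_mem_support_step q S j b s hE
  have h := PointBlowup.apply_eq_of_coeff_translate_monomial_ne_zero b hbi hne
  rw [chartExponent_apply_of_ne q S hij] at h
  change PointBlowup.bigH s.F i ≤ ((E i : ℕ) : ℕ∞)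
  rw [h]
  exact bigH_le hd i

/-- **The transverse-linear slice.** Let `k` be the least `S`-degree of a monomial of `F`, `q ≤ k`, `q ≠ 1`,
and `y^{d₀}` a monomial of `F` of `S`-degree `k`, linear in exactly one variable `t` off `S`.  For every
`ρ` below the relevant chart exponents (`ρ_j = k − q`, `ρ_i ≤ d_i` (`i ≠ j`) for every such monomial `y^d`)
and every `D` with `|d| + (k − q) ≤ |ρ| + D + d_j` for them, the residual polynomial after the `C_S`-step in
the chart `j ∈ S` at a point `b` of the fibre over the origin has a monomial `y^E` with `E_j = k − q`,
`E_t = 1` and `|E| ≤ |ρ|_{b = 0} + D` (layer lemma of `PointBlowupMohBound`; cleaning does not touch the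
slice since `E_t = 1`). [folklore] -/
private theorem exists_monomial_step (q : ℕ) (hq1 : q ≠ 1) {S : Finset σ} {j : σ} (hj : j ∈ S)
    (b : σ → K) (hbj : b j = 0) (hbN : ∀ i, i ∉ S → b i = 0) (s : CState σ K)
    {k : ℕ} (hqk : q ≤ k) (hmin : ∀ d ∈ s.F.support, k ≤ degIn S d)
    {d₀ : σ →₀ ℕ} (hd₀ : d₀ ∈ s.F.support) (hd₀k : degIn S d₀ = k) {t : σ} (ht : t ∉ S)
    (hd₀t : d₀ t = 1) (hd₀N : ∀ u, u ∉ S → u ≠ t → d₀ u = 0)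
    (ρ : σ →₀ ℕ) (hρj : ρ j = k - q)
    (hρ : ∀ d ∈ s.F.support, degIn S d = k → d t = 1 → (∀ u, u ∉ S → u ≠ t → d u = 0) →
      ∀ i, i ≠ j → ρ i ≤ d i)
    (D : ℕ) (hD : ∀ d ∈ s.F.support, degIn S d = k → d t = 1 → (∀ u, u ∉ S → u ≠ t → d u = 0) →
      d.degree + (k - q) ≤ ρ.degree + D + d j) :
    ∃ E ∈ (step q S j b s).F.support,
      E j = k - q ∧ E t = 1 ∧ E.degree ≤ (ρ.filter fun i => b i = 0).degree + D := by
  classical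
  have htj : t ≠ j := by rintro rfl; exact ht hj
  -- the transverse-linear monomials with transverse variable `t` and their chart image `P`
  set fam : Finset (σ →₀ ℕ) :=
    s.F.support.filter (fun d => degIn S d = k ∧ d t = 1 ∧ ∀ u, u ∉ S → u ≠ t → d u = 0) with hfam
  set P : MvPolynomial σ K := ∑ d ∈ fam, monomial (chartExponent q S j d) (coeff d s.F) with hP
  have hd₀fam : d₀ ∈ fam := Finset.mem_filter.mpr ⟨hd₀, hd₀k, hd₀t, hd₀N⟩
  have hfam_mem : ∀ d ∈ fam,
      d ∈ s.F.support ∧ degIn S d = k ∧ d t = 1 ∧ ∀ u, u ∉ S → u ≠ t → d u = 0 := fun d hd => by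
    obtain ⟨h1, h2, h3, h4⟩ := Finset.mem_filter.mp hd
    exact ⟨h1, h2, h3, h4⟩
  -- the support of `P`
  have hPsupp : ∀ e ∈ P.support, ∃ d ∈ fam, chartExponent q S j d = e := fun e he => by
    by_contra hne
    push Not at hne
    apply MvPolynomial.mem_support_iff.mp he
    rw [hP, coeff_sum]
    exact Finset.sum_eq_zero fun d hd => by rw [coeff_monomial, if_neg (hne d hd)]
  have hPd₀ : coeff (chartExponent q S j d₀) P = coeff d₀ s.F := by
    rw [hP, coeff_sum, Finset.sum_eq_single_of_mem d₀ hd₀fam]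
    · rw [coeff_monomial, if_pos rfl]
    · intro d hd hne
      rw [coeff_monomial, if_neg]
      intro h
      exact hne (eq_of_chartExponent_eq q hj (hfam_mem d hd).2.1 hd₀k h)
  -- hypotheses of the layer lemma
  have hρle : ∀ e ∈ P.support, ρ ≤ e := fun e he => by
    obtain ⟨d, hd, rfl⟩ := hPsupp e he
    obtain ⟨hdF, hdk, hdt, hdN⟩ := hfam_mem d hd
    rw [Finsupp.le_def]
    intro i
    by_cases hi : i = j
    · subst hi
      rw [hρj, chartExponent_apply_self, hdk]
    · rw [chartExponent_apply_of_ne q S hi]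
      exact hρ d hdF hdk hdt hdN i hi
  have hDle : ∀ e ∈ P.support, e j = ρ j → e.degree ≤ ρ.degree + D := fun e he _ => by
    obtain ⟨d, hd, rfl⟩ := hPsupp e he
    obtain ⟨hdF, hdk, hdt, hdN⟩ := hfam_mem d hd
    have h1 := degree_chartExponent_add q S j d
    rw [hdk] at h1
    have h2 := hD d hdF hdk hdt hdN
    omega
  have hlayer : ∃ e ∈ P.support, e j = ρ j :=
    ⟨chartExponent q S j d₀,
      MvPolynomial.mem_support_iff.mpr (by rw [hPd₀]; exact MvPolynomial.mem_support_iff.mp hd₀),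
      by rw [chartExponent_apply_self, hρj, hd₀k]⟩
  obtain ⟨E, hE, hEj, hEdeg⟩ :=
    PointBlowup.exists_mem_support_translate_layer b hbj P ρ hρle D hDle hlayer
  -- the translated slice, termwise
  have hsumP : PointBlowup.translate b P =
      ∑ d ∈ fam, PointBlowup.translate b (monomial (chartExponent q S j d) (coeff d s.F)) := by
    rw [hP]
    unfold PointBlowup.translate
    rw [map_sum]
  -- `E_t = 1` and `E_u = 0` for the other variables off `S`
  have hEt : E t = 1 ∧ ∀ u, u ∉ S → u ≠ t → E u = 0 := by
    have hne := MvPolynomial.mem_support_iff.mp hE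
    rw [hsumP, coeff_sum] at hne
    obtain ⟨d, hd, hdne⟩ := Finset.exists_ne_zero_of_sum_ne_zero hne
    obtain ⟨-, -, hdt, hdN⟩ := hfam_mem d hd
    refine ⟨?_, fun u hu hut => ?_⟩
    · rw [PointBlowup.apply_eq_of_coeff_translate_monomial_ne_zero b (hbN t ht) hdne,
        chartExponent_apply_of_ne q S htj, hdt]
    · have huj : u ≠ j := by rintro rfl; exact hu hj
      rw [PointBlowup.apply_eq_of_coeff_translate_monomial_ne_zero b (hbN u hu) hdne,
        chartExponent_apply_of_ne q S huj, hdN u hu hut]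
  -- the slice of the point transform is the translate of `P`
  have hslice : coeff E (pointTransform q S j b s) = coeff E (PointBlowup.translate b P) := by
    rw [pointTransform_eq_sum, hsumP, coeff_sum, coeff_sum, hfam]
    symm
    apply Finset.sum_filter_of_ne
    intro d hdF hne
    have hj' := PointBlowup.apply_eq_of_coeff_translate_monomial_ne_zero b hbj hne
    have ht' := PointBlowup.apply_eq_of_coeff_translate_monomial_ne_zero b (hbN t ht) hne
    refine ⟨?_, ?_, fun u hu hut => ?_⟩
    · have h1 : degIn S d - q = k - q := by rw [← chartExponent_apply_self q S j d, ← hj', hEj, hρj]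
      have h2 := hmin d hdF
      omega
    · rw [← chartExponent_apply_of_ne q S htj d, ← ht', hEt.1]
    · have huj : u ≠ j := by rintro rfl; exact hu hj
      have hu' := PointBlowup.apply_eq_of_coeff_translate_monomial_ne_zero b (hbN u hu) hne
      rw [← chartExponent_apply_of_ne q S huj d, ← hu', hEt.2 u hu hut]
  -- hence `y^E` is a monomial of the new residual polynomial (cleaning does not touch it)
  have hcoeffE : coeff E (step q S j b s).F ≠ 0 := by
    change coeff E (deletePthPowers q (pointTransform q S j b s)) ≠ 0
    rw [coeff_deletePthPowers, if_neg, hslice]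
    · exact MvPolynomial.mem_support_iff.mp hE
    · intro hpth
      have h1 := (isPthPowerExponent_iff q E).mp hpth t
      rw [hEt.1] at h1
      exact hq1 (Nat.dvd_one.mp h1)
  refine ⟨E, MvPolynomial.mem_support_iff.mpr hcoeffE, ?_, hEt.1, hEdeg⟩
  rw [hEj, hρj]

end Slice

/-! ## 4. The core estimate -/

section Core

variable {σ : Type*} {K : Type*} [Field K] [Fintype σ] [DecidableEq σ] [DecidableEq K]

omit [Field K] [DecidableEq σ] [DecidableEq K] in
/-- A monomial of `S`-degree `k`, linear in one variable `t ∉ S` and free of the other variables off `S`,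
has total degree `k + 1`. [folklore] -/
private theorem degree_eq_of_linearTransverse {S : Finset σ} {d : σ →₀ ℕ} {k : ℕ} (hdk : degIn S d = k)
    {t : σ} (ht : t ∉ S) (hdt : d t = 1) (hdN : ∀ u, u ∉ S → u ≠ t → d u = 0) :
    d.degree = k + 1 := by
  classical
  have h1 := degIn_add_sum_compl S d
  have h2 : ∑ i ∈ Sᶜ, d i = 1 := by
    rw [Finset.sum_eq_single_of_mem t (Finset.mem_compl.mpr ht)
      (fun u hu hut => hdN u (Finset.mem_compl.mp hu) hut), hdt]
  omega

omit [Field K] [Fintype σ] [DecidableEq σ] [DecidableEq K] in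
/-- casting a finite sum of finite `H_i`. [folklore] -/
private theorem sum_bigH_eq {L : Type*} [CommRing L] {F : MvPolynomial σ L} {H : σ → ℕ}
    (hH : ∀ i, PointBlowup.bigH F i = ((H i : ℕ) : ℕ∞)) (T : Finset σ) :
    ∑ i ∈ T, PointBlowup.bigH F i = ((∑ i ∈ T, H i : ℕ) : ℕ∞) := by
  rw [Nat.cast_sum]
  exact Finset.sum_congr rfl fun i _ => hH i

omit [Field K] [Fintype σ] [DecidableEq σ] [DecidableEq K] in
/-- For `F ≠ 0` the order at the origin is finite. [folklore] -/
private theorem ordZero_eq_toNat {L : Type*} [CommRing L] {F : MvPolynomial σ L} (hF : F ≠ 0) :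
    ordZero F = (((ordZero F).toNat : ℕ) : ℕ∞) := by
  have hne : ordZero F ≠ ⊤ := by
    unfold ordZero
    rw [Ne, MvPowerSeries.order_eq_top_iff, MvPolynomial.coe_eq_zero_iff]
    exact hF
  exact (ENat.coe_toNat hne).symm

/-- **Core estimate.** In the situation of the slice lemma with `ord₀ F = k + 1` (the centre is of the
"second kind" numerically: `ε(x) = ε(y) + 1` forces this, see `ordZero_eq_of_isSecondKind`), the new
residual polynomial at every point `b` of the fibre of the `y_j`-chart over the origin (`b_j = 0`, `b = 0`
off `S`) has a monomial `y^E`, linear in `t`, with `|E| − Σ_{i ∈ exc'} H_i(F') ≤ ε(x)`.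
Mechanism: `|E| ≤ (k − q) + 1 + (k − H_j − Σ_{i ∈ S∖j, bᵢ ≠ 0} Hᵢ)` from the layer lemma, while
`H_j(F') ≥ k − q` and `Hᵢ(F') ≥ Hᵢ(F)` at the untranslated old components. No hypothesis on `t ∈ exc`.
[folklore] (model computation of this cell; cf. the scheme-theoretic CP19 Thm. 3.6 / Prop. 3.3, not claimed here) -/
private theorem exists_monomial_epsilon_bound (q : ℕ) (hq1 : q ≠ 1) {S : Finset σ} {j : σ} (hj : j ∈ S)
    (b : σ → K) (hbj : b j = 0) (hbN : ∀ i, i ∉ S → b i = 0) (s : CState σ K)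
    {k : ℕ} (hqk : q ≤ k) (hmin : ∀ d ∈ s.F.support, k ≤ degIn S d)
    {d₀ : σ →₀ ℕ} (hd₀ : d₀ ∈ s.F.support) (hd₀k : degIn S d₀ = k) {t : σ} (ht : t ∉ S)
    (hd₀t : d₀ t = 1) (hd₀N : ∀ u, u ∉ S → u ≠ t → d₀ u = 0)
    (ho : ordZero s.F = ((k + 1 : ℕ) : ℕ∞)) :
    ∃ E ∈ (step q S j b s).F.support, E t = 1 ∧
      ((E.degree : ℕ) : ℕ∞) - ∑ i ∈ (step q S j b s).exc, PointBlowup.bigH (step q S j b s).F i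
        ≤ s.epsilon := by
  classical
  have hF : s.F ≠ 0 := by
    intro h
    rw [h, MvPolynomial.support_zero] at hd₀
    exact Finset.notMem_empty d₀ hd₀
  -- `H(x)` as natural numbers
  obtain ⟨H, hH⟩ : ∃ H : σ → ℕ, ∀ i, PointBlowup.bigH s.F i = ((H i : ℕ) : ℕ∞) :=
    ⟨fun i => (PointBlowup.bigH s.F i).toNat, fun i => bigH_eq_toNat hF i⟩
  have hHle : ∀ d ∈ s.F.support, ∀ i, H i ≤ d i := fun d hd i => by
    have h := bigH_le hd i
    rw [hH i] at h
    exact_mod_cast h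
  -- `Σ_i H_i ≤ |d₀| = k + 1`
  have hsumU : ∑ i, H i ≤ k + 1 := by
    calc ∑ i, H i ≤ ∑ i, d₀ i := Finset.sum_le_sum fun i _ => hHle d₀ hd₀ i
      _ = d₀.degree := degIn_univ d₀
      _ = k + 1 := degree_eq_of_linearTransverse hd₀k ht hd₀t hd₀N
  -- the exponent floor `ρ` (`ρ_j = k − q`, `ρ_i = H_i` otherwise) and the slack `D`
  obtain ⟨ρ, hρj, hρi, hρdeg⟩ : ∃ ρ : σ →₀ ℕ, ρ j = k - q ∧ (∀ i, i ≠ j → ρ i = H i) ∧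
      ρ.degree + H j = (∑ i, H i) + (k - q) := by
    refine ⟨(Finsupp.equivFunOnFinite.symm H).update j (k - q), ?_, fun i hi => ?_, ?_⟩
    · rw [Finsupp.update_apply, if_pos rfl]
    · rw [Finsupp.update_apply, if_neg hi, Finsupp.coe_equivFunOnFinite_symm]
    · have h1 := degree_update_add (Finsupp.equivFunOnFinite.symm H) j (k - q)
      have h2 : (Finsupp.equivFunOnFinite.symm H).degree = ∑ i, H i := by
        rw [← degIn_univ, degIn]
        exact Finset.sum_congr rfl fun i _ => by rw [Finsupp.coe_equivFunOnFinite_symm]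
      have h3 : (Finsupp.equivFunOnFinite.symm H) j = H j := by
        rw [Finsupp.coe_equivFunOnFinite_symm]
      rw [h3, h2] at h1
      exact h1
  obtain ⟨D, hD⟩ : ∃ D : ℕ, D = (k + 1) - ∑ i, H i := ⟨_, rfl⟩
  -- the slice lemma
  obtain ⟨E, hE, hEj, hEt, hEdeg⟩ := exists_monomial_step q hq1 hj b hbj hbN s hqk hmin hd₀ hd₀k
    ht hd₀t hd₀N ρ hρj (fun d hd _ _ _ i hi => by rw [hρi i hi]; exact hHle d hd i) D
    (fun d hd hdk hdt hdN => by
      rw [degree_eq_of_linearTransverse hdk ht hdt hdN]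
      have h1 := hHle d hd j
      omega)
  refine ⟨E, hE, hEt, ?_⟩
  -- `H(x')` as natural numbers, with its lower bounds
  have hF' : (step q S j b s).F ≠ 0 :=
    MvPolynomial.ne_zero_iff.mpr ⟨E, MvPolynomial.mem_support_iff.mp hE⟩
  obtain ⟨H', hH'⟩ :
      ∃ H' : σ → ℕ, ∀ i, PointBlowup.bigH (step q S j b s).F i = ((H' i : ℕ) : ℕ∞) :=
    ⟨fun i => (PointBlowup.bigH (step q S j b s).F i).toNat, fun i => bigH_eq_toNat hF' i⟩
  have hH'j : k - q ≤ H' j := by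
    have h := le_bigH_step_self q S j b hbj s hmin
    rw [hH' j] at h
    exact_mod_cast h
  have hH'i : ∀ i, i ≠ j → b i = 0 → H i ≤ H' i := fun i hij hbi => by
    have h := bigH_le_bigH_step q S hij b hbi s
    rw [hH i, hH' i] at h
    exact_mod_cast h
  -- (f1) `|ρ|_{b = 0} = (k − q) + Σ_{i ≠ j, bᵢ = 0} Hᵢ`
  have hf1 : (ρ.filter fun i => b i = 0).degree =
      (k - q) + ∑ i ∈ (Finset.univ.filter fun i => b i = 0).erase j, H i := by
    have h1 : (ρ.filter fun i => b i = 0).degree =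
        ∑ i ∈ Finset.univ.filter (fun i => b i = 0), ρ i := by
      rw [← degIn_univ, degIn, Finset.sum_filter]
      exact Finset.sum_congr rfl fun i _ => by rw [Finsupp.filter_apply]
    rw [h1, ← Finset.add_sum_erase _ (fun i => ρ i)
      (Finset.mem_filter.mpr ⟨Finset.mem_univ j, hbj⟩), hρj]
    congr 1
    exact Finset.sum_congr rfl fun i hi => hρi i (Finset.ne_of_mem_erase hi)
  -- (f2) `Σ_i Hᵢ = H_j + Σ_{i ≠ j, bᵢ = 0} Hᵢ + Σ_{bᵢ ≠ 0} Hᵢ`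
  have hf2 : ∑ i, H i = H j + ∑ i ∈ (Finset.univ.filter fun i => b i = 0).erase j, H i +
      ∑ i ∈ Finset.univ.filter (fun i => ¬ b i = 0), H i := by
    rw [← Finset.sum_filter_add_sum_filter_not Finset.univ (fun i => b i = 0) H,
      ← Finset.add_sum_erase _ H (Finset.mem_filter.mpr ⟨Finset.mem_univ j, hbj⟩)]
  -- (f3) `Σ_{exc} Hᵢ ≤ H_j + Σ_{exc∖j, bᵢ = 0} Hᵢ + Σ_{bᵢ ≠ 0} Hᵢ`
  have hf3 : ∑ i ∈ s.exc, H i ≤ H j + ∑ i ∈ (s.exc.filter fun i => b i = 0).erase j, H i +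
      ∑ i ∈ Finset.univ.filter (fun i => ¬ b i = 0), H i := by
    rw [← Finset.sum_filter_add_sum_filter_not s.exc (fun i => b i = 0) H]
    have h1 : ∑ i ∈ s.exc.filter (fun i => b i = 0), H i ≤
        H j + ∑ i ∈ (s.exc.filter fun i => b i = 0).erase j, H i := by
      by_cases hjx : j ∈ s.exc.filter (fun i => b i = 0)
      · rw [← Finset.add_sum_erase _ H hjx]
      · rw [Finset.erase_eq_of_notMem hjx]
        exact Nat.le_add_left _ _
    have h2 : ∑ i ∈ s.exc.filter (fun i => ¬ b i = 0), H i ≤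
        ∑ i ∈ Finset.univ.filter (fun i => ¬ b i = 0), H i :=
      Finset.sum_le_sum_of_subset (Finset.filter_subset_filter _ (Finset.subset_univ _))
    omega
  -- (f4) `Σ_{exc'} Hᵢ(F') ≥ (k − q) + Σ_{exc∖j, bᵢ = 0} Hᵢ`
  have hf4 : (k - q) + ∑ i ∈ (s.exc.filter fun i => b i = 0).erase j, H i ≤
      ∑ i ∈ (step q S j b s).exc, H' i := by
    have hexc : (step q S j b s).exc = insert j ((s.exc.filter fun i => b i = 0).erase j) := by
      change newExc j b s = _
      unfold newExc
      ext i
      simp only [Finset.mem_insert, Finset.mem_erase]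
      by_cases hi : i = j
      · simp [hi]
      · simp [hi]
    rw [hexc, Finset.sum_insert (Finset.notMem_erase j _)]
    refine Nat.add_le_add hH'j (Finset.sum_le_sum fun i hi => ?_)
    have h1 := Finset.mem_erase.mp hi
    exact hH'i i h1.1 (Finset.mem_filter.mp h1.2).2
  -- assemble
  rw [hf1] at hEdeg
  rw [CState.epsilon_eq, ho, sum_bigH_eq hH, sum_bigH_eq hH', ← ENat.coe_sub, ← ENat.coe_sub]
  have hnat : E.degree - ∑ i ∈ (step q S j b s).exc, H' i ≤ (k + 1) - ∑ i ∈ s.exc, H i := by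
    omega
  exact_mod_cast hnat

/-! ## 5. The two monotonicity theorems -/

/-- **`ε(x') ≤ ε(x)` at a centre of the second kind** — [CP19, Thm. 3.6 (1)] read contrapositively
("if `ε(x') > ε(x)` … `ε(y) = ε(x)`": a centre with `ε(y) = ε(x) − 1` admits no increase of `ε`), in the
model, from the numerical data of Def. 3.2 / Prop. 3.3 alone: `q ≠ 1`, chart `j ∈ S`, point of the
fibre over `x`, least `S`-degree `k ≥ q`, a transverse-linear monomial of `S`-degree `k`, `ord₀ F = k + 1`
(any boundary `exc`, any position of `t`). [cite: CossartPiltant2019, Thm. 3.6 (1) (p. 35) with Def. 3.2 and Prop. 3.3 (p. 32)] -/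
theorem epsilon_step_le (q : ℕ) (hq1 : q ≠ 1) {S : Finset σ} {j : σ} (hj : j ∈ S)
    (b : σ → K) (hbj : b j = 0) (hbN : ∀ i, i ∉ S → b i = 0) (s : CState σ K)
    {k : ℕ} (hqk : q ≤ k) (hmin : ∀ d ∈ s.F.support, k ≤ degIn S d)
    {d₀ : σ →₀ ℕ} (hd₀ : d₀ ∈ s.F.support) (hd₀k : degIn S d₀ = k) {t : σ} (ht : t ∉ S)
    (hd₀t : d₀ t = 1) (hd₀N : ∀ u, u ∉ S → u ≠ t → d₀ u = 0)
    (ho : ordZero s.F = ((k + 1 : ℕ) : ℕ∞)) :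
    (step q S j b s).epsilon ≤ s.epsilon := by
  obtain ⟨E, hE, -, hle⟩ :=
    exists_monomial_epsilon_bound q hq1 hj b hbj hbN s hqk hmin hd₀ hd₀k ht hd₀t hd₀N ho
  refine le_trans ?_ hle
  rw [CState.epsilon_eq]
  exact tsub_le_tsub_right
    (ordZero_le_of_coeff_ne_zero _ E (MvPolynomial.mem_support_iff.mp hE)) _

/-- **`ω(x') ≤ ω(x)` at a centre of the second kind with `t ∉ exc`** — [CP19, Thm. 3.6]
("`(m(x'), ω(x'), κ(x')) ≤ (m(x), ω(x), κ(x))`") for such centres, in the model: either `ord₀ F' < |E|`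
and `ε' ≤ ε − 1 ≤ ω`, or the slice monomial lies in the new initial form and its `∂/∂y_t` (`t ∉ exc'`)
gives `V' ≠ 0`, `ω' = ε' − 1 ≤ ω`.  Remark 3.2 (p. 41: `t = u₃ ∈ E`, `ω : p → p + 1`) shows the clause
`t ∉ exc` — i.e. Def. 3.2 (iii) — cannot be dropped. [cite: CossartPiltant2019, Thm. 3.6 (p. 35) and Remark 3.2 (p. 41)] -/
theorem omega_step_le (q : ℕ) (hq1 : q ≠ 1) {S : Finset σ} {j : σ} (hj : j ∈ S)
    (b : σ → K) (hbj : b j = 0) (hbN : ∀ i, i ∉ S → b i = 0) (s : CState σ K)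
    {k : ℕ} (hqk : q ≤ k) (hmin : ∀ d ∈ s.F.support, k ≤ degIn S d)
    {d₀ : σ →₀ ℕ} (hd₀ : d₀ ∈ s.F.support) (hd₀k : degIn S d₀ = k) {t : σ} (ht : t ∉ S)
    (htE : t ∉ s.exc) (hd₀t : d₀ t = 1) (hd₀N : ∀ u, u ∉ S → u ≠ t → d₀ u = 0)
    (ho : ordZero s.F = ((k + 1 : ℕ) : ℕ∞)) :
    (step q S j b s).omega ≤ s.omega := by
  classical
  obtain ⟨E, hE, hEt, hle⟩ :=
    exists_monomial_epsilon_bound q hq1 hj b hbj hbN s hqk hmin hd₀ hd₀k ht hd₀t hd₀N ho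
  have htj : t ≠ j := by rintro rfl; exact ht hj
  have hcoeffE := MvPolynomial.mem_support_iff.mp hE
  have hF' : (step q S j b s).F ≠ 0 := MvPolynomial.ne_zero_iff.mpr ⟨E, hcoeffE⟩
  have ho' := ordZero_eq_toNat hF'
  have ho'le : (ordZero (step q S j b s).F).toNat ≤ E.degree := by
    have h := ordZero_le_of_coeff_ne_zero _ E hcoeffE
    rw [ho'] at h
    exact_mod_cast h
  rcases ho'le.lt_or_eq with hlt | heq
  · -- the order dropped below the slice: `ε' ≤ ε − 1 ≤ ω`
    calc (step q S j b s).omega ≤ (step q S j b s).epsilon := CState.omega_le_epsilon _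
      _ ≤ ((E.degree : ℕ) : ℕ∞) - 1 -
            ∑ i ∈ (step q S j b s).exc, PointBlowup.bigH (step q S j b s).F i := by
          rw [CState.epsilon_eq, ho']
          refine tsub_le_tsub_right ?_ _
          rw [← Nat.cast_one, ← ENat.coe_sub]
          exact_mod_cast Nat.le_sub_one_of_lt hlt
      _ = ((E.degree : ℕ) : ℕ∞) -
            ∑ i ∈ (step q S j b s).exc, PointBlowup.bigH (step q S j b s).F i - 1 :=
          tsub_right_comm
      _ ≤ s.epsilon - 1 := tsub_le_tsub_right hle 1
      _ ≤ s.omega := s.epsilon_sub_one_le_omega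
  · -- the slice realises the order: `V' ≠ 0` through `∂/∂y_t`, `t ∉ exc'`
    have hV : PointBlowup.VNonzero (step q S j b s).exc (step q S j b s).F := by
      refine ⟨t, ?_, fun h0 => ?_⟩
      · change t ∉ newExc j b s
        unfold newExc
        rw [Finset.mem_insert, Finset.mem_filter]
        rintro (h | h)
        · exact htj h
        · exact htE h.1
      · have h1 := congrArg (coeff (E - Finsupp.single t 1)) h0
        have hle1 : Finsupp.single t 1 ≤ E := Finsupp.single_le_iff.mpr (by rw [hEt])
        have hEt' : (E - Finsupp.single t 1 : σ →₀ ℕ) t = 0 := by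
          rw [Finsupp.tsub_apply, Finsupp.single_eq_same, hEt]
        rw [MvPolynomial.coeff_pderiv, coeff_zero, tsub_add_cancel_of_le hle1, hEt', initialForm,
          coeff_homogeneousComponent, if_pos (by rw [ho']; exact heq.symm)] at h1
        apply hcoeffE
        simpa using h1
    rw [CState.omega_eq_of_vNonzero _ hV]
    calc (step q S j b s).epsilon - 1
        ≤ ((E.degree : ℕ) : ℕ∞) -
            ∑ i ∈ (step q S j b s).exc, PointBlowup.bigH (step q S j b s).F i - 1 := by
          refine tsub_le_tsub_right ?_ 1
          rw [CState.epsilon_eq]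
          exact tsub_le_tsub_right (ordZero_le_of_coeff_ne_zero _ E hcoeffE) _
      _ ≤ s.epsilon - 1 := tsub_le_tsub_right hle 1
      _ ≤ s.omega := s.epsilon_sub_one_le_omega

end Core

/-! ## 6. Centres of the second kind (CP19 Def. 3.2 with (iii)) -/

section SecondKind

variable {σ : Type*} {K : Type*} [Field K] [Fintype σ] [DecidableEq σ] [DecidableEq K]

omit [DecidableEq K] in
/-- **Numerical content of Def. 3.2.** If `C_S` is of the second kind at the state `s` (typed
`IsSecondKind`: Hironaka-permissible, `ε(y) + 1 = ε(x)`, and a transverse-linear monomial with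
`t ∉ S ∪ exc`), then with `k := ord_{C_S} F`: `q ≤ k`, every monomial has `S`-degree `≥ k`, the
transverse-linear monomial has `S`-degree `k`, and `ord₀ F = k + 1`. [folklore] -/
private theorem secondKind_data {q : ℕ} {S : Finset σ} {s : CState σ K} (h2 : IsSecondKind q S s) :
    ∃ k : ℕ, ∃ d₀ ∈ s.F.support, ∃ t : σ, q ≤ k ∧ (∀ d ∈ s.F.support, k ≤ degIn S d) ∧
      degIn S d₀ = k ∧ t ∉ S ∧ t ∉ s.exc ∧ d₀ t = 1 ∧ (∀ u, u ∉ S → u ≠ t → d₀ u = 0) ∧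
      ordZero s.F = ((k + 1 : ℕ) : ℕ∞) := by
  classical
  obtain ⟨⟨-, hq⟩, hii, d₀, hd₀, hdeg, t, ht, htE, hd₀t, hd₀N⟩ := h2
  have hF : s.F ≠ 0 := by
    intro h
    rw [h, MvPolynomial.support_zero] at hd₀
    exact Finset.notMem_empty d₀ hd₀
  have hmin : ∀ d ∈ s.F.support, degIn S d₀ ≤ degIn S d := fun d hd => by
    have h : ordAlong S s.F ≤ (degIn S d : ℕ∞) := Finset.inf_le hd
    rw [← hdeg] at h
    exact_mod_cast h
  have hqk : q ≤ degIn S d₀ := by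
    rw [← hdeg] at hq
    exact_mod_cast hq
  refine ⟨degIn S d₀, d₀, hd₀, t, hqk, hmin, rfl, ht, htE, hd₀t, hd₀N, ?_⟩
  -- `ord₀ F = k + 1` from (ii): `ε(y) + 1 = ε(x)`
  obtain ⟨H, hH⟩ : ∃ H : σ → ℕ, ∀ i, PointBlowup.bigH s.F i = ((H i : ℕ) : ℕ∞) :=
    ⟨fun i => (PointBlowup.bigH s.F i).toNat, fun i => bigH_eq_toNat hF i⟩
  have hHle : ∀ i, H i ≤ d₀ i := fun i => by
    have h := bigH_le hd₀ i
    rw [hH i] at h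
    exact_mod_cast h
  have ho := ordZero_eq_toNat hF
  have hole : (ordZero s.F).toNat ≤ degIn S d₀ + 1 := by
    have h := ordZero_le_of_coeff_ne_zero _ d₀ (MvPolynomial.mem_support_iff.mp hd₀)
    rw [ho, degree_eq_of_linearTransverse rfl ht hd₀t hd₀N] at h
    exact_mod_cast h
  have hA : ∑ i ∈ S ∩ s.exc, H i ≤ degIn S d₀ :=
    le_trans (Finset.sum_le_sum fun i _ => hHle i) (Finset.sum_le_sum_of_subset Finset.inter_subset_left)
  have hAB : ∑ i ∈ S ∩ s.exc, H i ≤ ∑ i ∈ s.exc, H i :=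
    Finset.sum_le_sum_of_subset Finset.inter_subset_right
  have hnat : degIn S d₀ - ∑ i ∈ S ∩ s.exc, H i + 1 = (ordZero s.F).toNat - ∑ i ∈ s.exc, H i := by
    have h := hii
    unfold epsilonAlong at h
    rw [CState.epsilon_eq, ← hdeg, ho, sum_bigH_eq hH, sum_bigH_eq hH, ← ENat.coe_sub,
      ← ENat.coe_sub] at h
    exact_mod_cast h
  rw [ho]
  have : (ordZero s.F).toNat = degIn S d₀ + 1 := by omega
  exact_mod_cast this

omit [DecidableEq K] in
/-- **Prop. 3.3, last clause, in the model: `ε(y) = ω(x)`** at a centre of the second kind — the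
transverse-linear monomial lies in the initial form and its `∂/∂y_t` (`t ∉ exc`) makes `V ≠ 0`, so
`ω(x) = ε(x) − 1 = ε(y)`. [folklore] (the model's rendering of the last clause of CP19 Prop. 3.3; not the published
statement) -/
private theorem omega_eq_epsilonAlong_of_isSecondKind {q : ℕ} {S : Finset σ} {s : CState σ K}
    (h2 : IsSecondKind q S s) : s.omega = epsilonAlong S s := by
  classical
  have hii := h2.2.1
  obtain ⟨k, d₀, hd₀, t, -, -, hd₀k, ht, htE, hd₀t, hd₀N, ho⟩ := secondKind_data h2
  have hcoeff := MvPolynomial.mem_support_iff.mp hd₀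
  have hV : PointBlowup.VNonzero s.exc s.F := by
    refine ⟨t, htE, fun h0 => ?_⟩
    have h1 := congrArg (coeff (d₀ - Finsupp.single t 1)) h0
    have hle1 : Finsupp.single t 1 ≤ d₀ := Finsupp.single_le_iff.mpr (by rw [hd₀t])
    have hdt' : (d₀ - Finsupp.single t 1 : σ →₀ ℕ) t = 0 := by
      rw [Finsupp.tsub_apply, Finsupp.single_eq_same, hd₀t]
    rw [MvPolynomial.coeff_pderiv, coeff_zero, tsub_add_cancel_of_le hle1, hdt', initialForm,
      coeff_homogeneousComponent,
      if_pos (by rw [ho, degree_eq_of_linearTransverse hd₀k ht hd₀t hd₀N]; rfl)] at h1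
    apply hcoeff
    simpa using h1
  rw [CState.omega_eq_of_vNonzero _ hV, ← hii]
  exact (ENat.addLECancellable_of_ne_top ENat.one_ne_top).add_tsub_cancel_right

/-- **No increase of `ε` under the blow-up of a centre of the second kind**, at every point of the
fibre over `x` in every chart `j ∈ S` (`q ≠ 1`) — [CP19, Thm. 3.6 (1)]: an increase of `ε` forces the
centre to be of the first kind. [cite: CossartPiltant2019, Thm. 3.6 (1) (p. 35)] -/
theorem not_epsilonIncreases_of_isSecondKind (q : ℕ) (hq1 : q ≠ 1) {S : Finset σ} {j : σ}
    (hj : j ∈ S) (b : σ → K) (hbj : b j = 0) (hbN : ∀ i, i ∉ S → b i = 0) (s : CState σ K)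
    (h2 : IsSecondKind q S s) : ¬ EpsilonIncreases q S j b s := by
  obtain ⟨k, d₀, hd₀, t, hqk, hmin, hd₀k, ht, -, hd₀t, hd₀N, ho⟩ := secondKind_data h2
  exact not_lt.mpr (epsilon_step_le q hq1 hj b hbj hbN s hqk hmin hd₀ hd₀k ht hd₀t hd₀N ho)

/-- **No increase of `ω` under the blow-up of a centre of the second kind**, at every point of the
fibre over `x` in every chart `j ∈ S` (`q ≠ 1`; no use of `ω(x) > 0` or of the equimultiplicity of
`x'`). [cite: CossartPiltant2019, Thm. 3.6 (p. 35)] -/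
theorem not_omegaIncreases_of_isSecondKind (q : ℕ) (hq1 : q ≠ 1) {S : Finset σ} {j : σ}
    (hj : j ∈ S) (b : σ → K) (hbj : b j = 0) (hbN : ∀ i, i ∉ S → b i = 0) (s : CState σ K)
    (h2 : IsSecondKind q S s) : ¬ OmegaIncreases q S j b s := by
  obtain ⟨k, d₀, hd₀, t, hqk, hmin, hd₀k, ht, htE, hd₀t, hd₀N, ho⟩ := secondKind_data h2
  exact not_lt.mpr (omega_step_le q hq1 hj b hbj hbN s hqk hmin hd₀ hd₀k ht htE hd₀t hd₀N ho)

/-- **[CP19, Thm. 3.6] read at one blow-up of a centre OF THE SECOND KIND, in the model: the atlas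
predicate `NoOmegaIncreaseAtCentre p S j b s` holds** (`p ≠ 1`).  The first-kind half of the
`ω`-monotonicity is not proved in the tree. [cite: CossartPiltant2019, Thm. 3.6 (p. 35)] -/
theorem noOmegaIncreaseAtCentre_of_isSecondKind (p : ℕ) (hp1 : p ≠ 1) (S : Finset σ) (j : σ)
    (b : σ → K) (s : CState σ K) (h2 : IsSecondKind p S s) : NoOmegaIncreaseAtCentre p S j b s :=
  fun hj hbj hbN _ _ _ _ => not_omegaIncreases_of_isSecondKind p hp1 hj b hbj hbN s h2

end SecondKind

end Literature.AlgebraicGeometry.Resolution.CentreBlowup.SecondKind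

end
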